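import Mathlib.Data.List.Basic
import Mathlib.Data.Nat.Notation
import HarnessLib

/-!
# Venture HSemireg — the g = 8 OBJECT CENSUS (n = 4) of record as KERNEL DATA: one record per line of
# `target-g8/CENSUS.md` §2 (custodian t-21), for the certified negative statement «NO-in-families-tried» (file `CensusG8Verdict.lean`)

HONEST FRAMING. Data file of a COMPUTATION cell (`pub-hsemireg`, Sunday typer seat p9). It TRANSCRIBES a census TABLE of
OBJECTS AND DESIGNS that the cell built and screened at named CM anchors of Weil-type abelian EIGHTFOLDS — it does not
construct any variety, sheaf, cohomology group or semiregularity map, and no number in the census is recomputed here. What the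
kernel checks (in `CensusG8Verdict.lean`) is BOOKKEEPING about this table: counts, buckets, and the coordinator's three-outcome
form as a FUNCTION of the table. Every cell below is the census custodian's / row owner's word, read by p9 from the file of
record; the reading is published cell by cell in `run/shared/lean/pub/pub-hsemireg/p9/CENSUS-G8-LEAN-MAP.tsv` for the numbers
referee. NOTHING HERE SAYS THAT HC, HC_CM OR HC_AV IS PROVED OR REFUTED; «candidate» would be the strongest pre-referee word and
no row carries it.

SOURCE OF RECORD. `run/shared/lean/pub/pub-hsemireg/target-g8/CENSUS.md` **v1.273, sha256/16 `8eb43b237c4e60ad`** (512 lines; §2 table =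
158 physical lines), the post-sign successor of the pair the SIGNED verdict prints (`target-g6/VERDICT-G6.md` v1.0
`1651dcc7322662a2`, § g = 8: CENSUS-g8 v1.271 `04259ba51062dcfc` ∕ INTERIM-G8 v0.233 `d2aff44eefca4b86`; the custodian's change
log records «NO count change» for v1.272 ∕ v1.273: numbers of record 148 counted ∕ 156 listed ∕ 158 physical, A 43 · B 74 · C 3 ·
P 5 · D 14 · K 9, listed-not-counted 8, CLASS-OK (family-B tally) 16, SEMIREG ∧ CLASS 0, candidates 0). Row extraction follows
the custodian's own rule (t-21 `numbers_line.py`: table lines `| <id> | …` whose id starts with A, AE, AW, B, BPTR, BFAM, BCOV,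
BTFL, C, CGE, P, PS, D or K; family letter = first letter; the 8 LISTED-NOT-COUNTED ids and the 2 ALIAS K-lines by name), which
is also the numbers referee's (ref-4 `census_parse_ref4.py`).

SCHEMA (one `Row` per physical §2 line; fields and their census columns):
* `id` (c1 verbatim) · `family` (§0 «Families»: A = Φ(⊠ point-ideal sheaves) and variants, B = twisted Poincaré-type ∕ graphs of
  K-isogenies with determinant twists, C = non-box secant-type objects on the eightfold, P = Porteous-type degeneracy loci,
  D = objects of record before the 11:27Z scale-up (negatives), K = engine calibration rows) · `status` (§3 roll-up rule:
  `counted` ∕ `listedNotCounted` ∕ `alias`) · `n` = the level the row's statement is about (`g = 2n`; 4 unless the row is a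
  ladder ∕ companion ∕ toy row at another n — then it is not a g = 8 statement) · `kind`: `member` = a constructed object (or an
  explicit finite list of objects) at a named anchor with its own class ∕ σ cells; `structureRow` = a family-level theorem ∕
  no-go ∕ door ∕ menu ∕ design ∕ instrument row («negative rows are rows»; no single object); `calibration` = engine
  calibration ∕ control ∕ sizing rows («not census objects», §0); `barrierAllObjects` = an all-object barrier at n = 4 (the
  «STRUCTURAL-NO» trigger of the three-outcome form) — NO ROW OF RECORD HAS THIS KIND.
* `cls` (c5 with c7): `ok` = CLASS-EXACT ∧ W-ALIVE (ch_k ∈ ℚh^k for k ≠ 4, ch₄ ∈ ℚh⁴ ⊕ W_K with W-part ≠ 0; for structure rows: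
  the classes in the row's scope are so by construction ∕ hypothesis) · `dead` = CLASS-DEAD (junk ≠ 0 or w = 0) · `undecided` ·
  `none` (no class cell ∕ not a class statement).
* `sigma` (c6 with c7): `injective` = SEMIREG (σ resp. Bloch's π injective, incl. on G-invariants for a door row) · `obstructed` =
  NOT-SEMIREG ∕ OBSTRUCTED (kernel > 0, a count ∕ pinch ∕ residue ∕ E₂ argument, or a theorem closing the row's scope) ·
  `undecided` (σ-UNDECIDED ∕ residue-immune ∕ fibre-alive: the row says which number is missing) · `none` (no σ number: a
  class-dead member needs none, §0; or not a σ statement).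
* `verdict` (c10, by its leading token; §0 VERDICT VOCABULARY): `semiregClass` = SEMIREG+CLASS (would be a CANDIDATE — no row) ·
  `semiregClassDead` = SEMIREG ∕ CLASS-DEAD (MISSES-CLASS, red-6 F-3′) · `classOkNotSemireg` = CLASS-OK ∕ NOT-SEMIREG ·
  `notSemireg` = NOT-SEMIREG (class half not worded in c10) · `classDead` = CLASS-DEAD (incl. «CLASS-DEAD ∧ NOT-SEMIREG») ·
  `noObject` = EMPTY ∕ NO-OBJECT ∕ NOT-AN-OBJECT ∕ SEARCH-NEGATIVE ∕ «CLASS-OK (witness), not an object» · `openOrUndecided` =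
  OPEN ∕ UNDECIDED ∕ LEAD ∕ IN PROGRESS (the live doors (d1)–(d7) of the signed § g = 8) · `structural` = STRUCTURE ∕ NEGATIVE ∕
  NO-GO ∕ THEOREM ∕ PROVED ∕ INSTRUMENT ∕ INFO ∕ PARTIAL NO-GO ∕ door-narrowing rows · `calibration` = CALIBRATION ∕ SIZING CONTROL.
* `tally` = membership in the numbers referee's «CLASS-OK (FAMILY-B TALLY)» bucket of record (ref-4 g14 bus l.7886 wording, adopted
  by the custodian; the signed § g = 8: 6 member rows NOT-SEMIREG {B20-0, B20-4, B20-5, B20-6, B19-6, B19-7} + 3 det-twist DESIGN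
  rows σ-UNDECIDED {B12n4-1, B12n4-2, B12n4-3} + 6 structural rows {B19-8, B19-20, B19-21, B19-22, B19-23, B19-24} + 1 virtual cone
  {B19-3} = 16; named outside it: D21-2 ∕ D21-3 ∕ D21-4 CLASS-OK ∕ NOT-SEMIREG and B20-3 «CLASS-OK (witness)»).
The multiplicities («×k codes ∕ seats») of the cells are NOT transcribed: no row is SEMIREG ∧ CLASS at ANY multiplicity, so the
YES-bar (class ×2 + σ ×2, ref-4 RISK-1) is never reached — exactly the signed text's «trivially met, there is none».

References: the cell files named above (hash-pinned); [Bloch1972Semiregularity] S. Bloch, Invent. Math. 17 (1972) §1;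
[BuchweitzFlenner2003] R.-O. Buchweitz, H. Flenner, Compositio Math. 137 (2003) (8.1) — for what «semiregular» means in the
census (the map whose injectivity the engines decide); nothing of either paper is used or restated here.
-/

namespace Summit.Ventures.HSemireg.CensusG8

/-- Object family of a CENSUS-g8 row (§0 «Families»; the family letter is the first letter of the row id, as in the custodian's
and the numbers referee's parsers). [bookkeeping] -/
inductive Family | A | B | C | P | D | K
  deriving DecidableEq, Repr

/-- Counting status of a §2 line (§3 roll-up rule of record): counted · listed-not-counted (8 named rows) · alias K-line carried
once (2 named rows). [bookkeeping] -/
inductive Status | counted | listedNotCounted | alias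
  deriving DecidableEq, Repr

/-- What a row IS: a constructed object (`member`), a family-level structure ∕ theorem ∕ no-go ∕ door ∕ menu ∕ design ∕ instrument row
(`structureRow`), an engine calibration ∕ control row (`calibration`), or an ALL-OBJECT barrier at n = 4 (`barrierAllObjects`, the
«STRUCTURAL-NO» trigger — no row of record). [bookkeeping] -/
inductive Kind | member | structureRow | calibration | barrierAllObjects
  deriving DecidableEq, Repr

/-- The CLASS half of a row (census column c5 read with c7): CLASS-EXACT ∧ W-ALIVE (`ok`), CLASS-DEAD (`dead`), undecided, or no
class cell. [bookkeeping] -/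
inductive ClassCell | ok | dead | undecided | none
  deriving DecidableEq, Repr

/-- The SEMIREGULARITY half of a row (census column c6 read with c7): σ ∕ π injective (`injective`), NOT-SEMIREG ∕ OBSTRUCTED
(`obstructed`), σ-undecided, or no σ number. [bookkeeping] -/
inductive SigmaCell | injective | obstructed | undecided | none
  deriving DecidableEq, Repr

/-- The verdict cell c10 by its leading token (§0 VERDICT VOCABULARY of the census; see the module docstring for the map).
`semiregClass` = SEMIREG+CLASS would be a CANDIDATE; no row of record carries it. [bookkeeping] -/
inductive Verdict
  | semiregClass | semiregClassDead | classOkNotSemireg | notSemireg | classDead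
  | noObject | openOrUndecided | structural | calibration
  deriving DecidableEq, Repr

/-- One physical line of CENSUS-g8 §2 (fields ↔ census columns: see the module docstring). [bookkeeping] -/
structure Row where
  /-- row id, census column c1 verbatim -/
  id : String
  /-- family letter (first letter of the id) -/
  family : Family
  /-- counted ∕ listed-not-counted ∕ alias (§3 roll-up rule) -/
  status : Status
  /-- the level `n` (`g = 2n`) the row's statement is about; 4 = a g = 8 statement -/
  n : ℕ
  /-- member ∕ structure row ∕ calibration ∕ all-object barrier -/
  kind : Kind
  /-- CLASS half -/
  cls : ClassCell
  /-- SEMIREGULARITY half -/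
  sigma : SigmaCell
  /-- verdict cell by leading token -/
  verdict : Verdict
  /-- member of the referee's CLASS-OK (family-B) tally bucket of record -/
  tally : Bool
  deriving DecidableEq, Repr

/-- **CENSUS-g8 §2 as kernel data**: the 158 physical table lines of `target-g8/CENSUS.md` v1.273 `8eb43b237c4e60ad` in file order
(§2.A l.29–76, §2.B l.81–154, §2.C l.159–161, §2.P l.167–176, §2.D l.181–194, §2.K l.199–209), one `Row` each, cells transcribed as
documented in the module docstring and, cell by cell with the census excerpt, in `p9/CENSUS-G8-LEAN-MAP.tsv`. [bookkeeping;
transcription of the cell's census of record — the engines' numbers behind each cell are NOT recomputed here] -/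
def census : List Row := [
  ⟨"AFAM-1", .A, .counted, 4, .structureRow, .dead, .none, .classDead, false⟩,
  ⟨"AE2-1", .A, .counted, 4, .member, .dead, .injective, .semiregClassDead, false⟩,
  ⟨"A17-2", .A, .counted, 4, .member, .dead, .obstructed, .classDead, false⟩,
  ⟨"A17-3", .A, .counted, 4, .member, .dead, .injective, .semiregClassDead, false⟩,
  ⟨"A17-4", .A, .counted, 4, .member, .dead, .injective, .semiregClassDead, false⟩,
  ⟨"A17-J0", .A, .counted, 4, .structureRow, .ok, .none, .openOrUndecided, false⟩,
  ⟨"A17-J1", .A, .counted, 3, .structureRow, .none, .none, .noObject, false⟩,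
  ⟨"A17-J2", .A, .counted, 4, .calibration, .none, .none, .calibration, false⟩,
  ⟨"A17-J3", .A, .counted, 4, .structureRow, .ok, .none, .openOrUndecided, false⟩,
  ⟨"A17-J4", .A, .counted, 4, .structureRow, .none, .none, .noObject, false⟩,
  ⟨"A17-J5", .A, .listedNotCounted, 2, .calibration, .ok, .none, .calibration, false⟩,
  ⟨"A17-J6", .A, .counted, 4, .structureRow, .ok, .none, .openOrUndecided, false⟩,
  ⟨"A17-J7", .A, .counted, 4, .structureRow, .none, .none, .noObject, false⟩,
  ⟨"A17-J8", .A, .counted, 4, .structureRow, .none, .none, .noObject, false⟩,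
  ⟨"A17-J9", .A, .counted, 4, .structureRow, .none, .none, .noObject, false⟩,
  ⟨"A17-J10", .A, .counted, 4, .structureRow, .none, .none, .noObject, false⟩,
  ⟨"A17-J11", .A, .counted, 4, .structureRow, .none, .none, .noObject, false⟩,
  ⟨"A17-J12", .A, .counted, 4, .structureRow, .none, .none, .structural, false⟩,
  ⟨"A17-J13", .A, .counted, 4, .structureRow, .ok, .none, .openOrUndecided, false⟩,
  ⟨"A17-I1", .A, .counted, 4, .structureRow, .ok, .obstructed, .structural, false⟩,
  ⟨"A17-I2", .A, .counted, 4, .structureRow, .ok, .obstructed, .structural, false⟩,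
  ⟨"A17-I3", .A, .counted, 4, .structureRow, .ok, .obstructed, .structural, false⟩,
  ⟨"A17-T1", .A, .counted, 4, .structureRow, .dead, .none, .classDead, false⟩,
  ⟨"A17-T3", .A, .counted, 4, .structureRow, .none, .none, .structural, false⟩,
  ⟨"A17-T0", .A, .counted, 4, .structureRow, .none, .none, .structural, false⟩,
  ⟨"A17-T5", .A, .counted, 4, .structureRow, .dead, .none, .structural, false⟩,
  ⟨"A17-T6", .A, .counted, 4, .structureRow, .none, .none, .structural, false⟩,
  ⟨"A18-J1", .A, .counted, 4, .structureRow, .none, .obstructed, .structural, false⟩,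
  ⟨"A18-1", .A, .counted, 4, .member, .dead, .injective, .semiregClassDead, false⟩,
  ⟨"A18-2", .A, .counted, 4, .member, .dead, .injective, .semiregClassDead, false⟩,
  ⟨"A18-3", .A, .counted, 4, .member, .dead, .injective, .semiregClassDead, false⟩,
  ⟨"A18-4", .A, .counted, 4, .member, .dead, .injective, .semiregClassDead, false⟩,
  ⟨"A18-5", .A, .counted, 4, .member, .dead, .injective, .semiregClassDead, false⟩,
  ⟨"A18-6", .A, .counted, 4, .member, .dead, .injective, .semiregClassDead, false⟩,
  ⟨"A18-7", .A, .counted, 4, .member, .dead, .obstructed, .classDead, false⟩,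
  ⟨"A18-8", .A, .counted, 4, .member, .dead, .injective, .semiregClassDead, false⟩,
  ⟨"A18-9", .A, .counted, 4, .member, .dead, .injective, .semiregClassDead, false⟩,
  ⟨"A18-10", .A, .counted, 4, .member, .dead, .injective, .semiregClassDead, false⟩,
  ⟨"A18-11", .A, .counted, 4, .member, .dead, .injective, .semiregClassDead, false⟩,
  ⟨"A18-12", .A, .counted, 4, .member, .dead, .injective, .semiregClassDead, false⟩,
  ⟨"A18-13", .A, .counted, 4, .member, .dead, .injective, .semiregClassDead, false⟩,
  ⟨"A18-14", .A, .counted, 4, .member, .dead, .obstructed, .classDead, false⟩,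
  ⟨"A18-15", .A, .listedNotCounted, 5, .member, .dead, .obstructed, .classDead, false⟩,
  ⟨"A18-S", .A, .counted, 4, .structureRow, .dead, .none, .classDead, false⟩,
  ⟨"A18-V", .A, .counted, 4, .structureRow, .ok, .obstructed, .structural, false⟩,
  ⟨"AW3-1", .A, .listedNotCounted, 4, .structureRow, .dead, .none, .classDead, false⟩,
  ⟨"BFAM-20", .B, .counted, 4, .structureRow, .none, .none, .structural, false⟩,
  ⟨"B20-0", .B, .counted, 4, .member, .ok, .obstructed, .classOkNotSemireg, true⟩,
  ⟨"B20-1", .B, .counted, 4, .member, .dead, .injective, .semiregClassDead, false⟩,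
  ⟨"B20-2", .B, .counted, 4, .member, .dead, .obstructed, .classDead, false⟩,
  ⟨"B20-3", .B, .counted, 4, .member, .ok, .none, .noObject, false⟩,
  ⟨"B20-4", .B, .counted, 4, .member, .ok, .obstructed, .classOkNotSemireg, true⟩,
  ⟨"B20-5", .B, .counted, 4, .member, .ok, .obstructed, .classOkNotSemireg, true⟩,
  ⟨"B20-6", .B, .counted, 4, .member, .ok, .obstructed, .classOkNotSemireg, true⟩,
  ⟨"B20-7", .B, .counted, 4, .member, .dead, .none, .classDead, false⟩,
  ⟨"B20-8", .B, .counted, 4, .structureRow, .dead, .none, .classDead, false⟩,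
  ⟨"BTHM-20", .B, .counted, 4, .structureRow, .ok, .obstructed, .structural, false⟩,
  ⟨"BWEB-20", .B, .counted, 4, .structureRow, .ok, .obstructed, .structural, false⟩,
  ⟨"BDEG-20", .B, .counted, 4, .structureRow, .none, .none, .structural, false⟩,
  ⟨"BRES-20", .B, .counted, 4, .structureRow, .ok, .obstructed, .structural, false⟩,
  ⟨"BOBT-20", .B, .counted, 4, .structureRow, .none, .none, .structural, false⟩,
  ⟨"BBLK-20", .B, .counted, 4, .structureRow, .ok, .obstructed, .structural, false⟩,
  ⟨"BFIB-20", .B, .counted, 4, .structureRow, .none, .undecided, .openOrUndecided, false⟩,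
  ⟨"BPEN-20", .B, .counted, 4, .structureRow, .none, .obstructed, .structural, false⟩,
  ⟨"BSLACK-20", .B, .counted, 4, .structureRow, .none, .none, .structural, false⟩,
  ⟨"BENG-20", .B, .counted, 4, .structureRow, .none, .none, .structural, false⟩,
  ⟨"BIMP-20", .B, .counted, 4, .structureRow, .none, .obstructed, .structural, false⟩,
  ⟨"BSTAR-20", .B, .counted, 4, .structureRow, .none, .undecided, .openOrUndecided, false⟩,
  ⟨"BCOS-20", .B, .counted, 4, .structureRow, .none, .none, .structural, false⟩,
  ⟨"BGRP-20", .B, .counted, 4, .structureRow, .none, .obstructed, .structural, false⟩,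
  ⟨"BDEC-20", .B, .counted, 4, .structureRow, .none, .none, .structural, false⟩,
  ⟨"BCLS-20", .B, .counted, 4, .structureRow, .ok, .none, .structural, false⟩,
  ⟨"BAST-20", .B, .counted, 4, .structureRow, .ok, .none, .structural, false⟩,
  ⟨"BBIP-20", .B, .counted, 4, .structureRow, .none, .none, .structural, false⟩,
  ⟨"BASD-20", .B, .counted, 4, .structureRow, .ok, .none, .structural, false⟩,
  ⟨"BCAT-20", .B, .counted, 4, .structureRow, .none, .none, .structural, false⟩,
  ⟨"BGH2-20", .B, .counted, 4, .structureRow, .none, .none, .structural, false⟩,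
  ⟨"BEF-20", .B, .counted, 4, .structureRow, .none, .none, .structural, false⟩,
  ⟨"BINR-20", .B, .counted, 4, .structureRow, .none, .none, .structural, false⟩,
  ⟨"BDSE-20", .B, .counted, 4, .structureRow, .none, .none, .structural, false⟩,
  ⟨"BM9-20", .B, .counted, 4, .structureRow, .none, .none, .structural, false⟩,
  ⟨"BCOV-20", .B, .counted, 4, .structureRow, .none, .none, .structural, false⟩,
  ⟨"BTFL-20", .B, .counted, 4, .structureRow, .none, .none, .structural, false⟩,
  ⟨"BX2G-20", .B, .counted, 4, .structureRow, .none, .none, .structural, false⟩,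
  ⟨"B24-2", .B, .counted, 4, .structureRow, .dead, .none, .classDead, false⟩,
  ⟨"BPTR-11", .B, .counted, 4, .structureRow, .dead, .obstructed, .classDead, false⟩,
  ⟨"B19-cal1", .B, .counted, 1, .calibration, .dead, .injective, .calibration, false⟩,
  ⟨"B19-cal2", .B, .counted, 2, .calibration, .ok, .injective, .calibration, false⟩,
  ⟨"B19-cal3", .B, .counted, 3, .calibration, .dead, .injective, .calibration, false⟩,
  ⟨"B19-1", .B, .counted, 4, .calibration, .dead, .injective, .calibration, false⟩,
  ⟨"B19-2", .B, .counted, 4, .member, .dead, .obstructed, .classDead, false⟩,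
  ⟨"B19-3", .B, .counted, 4, .structureRow, .ok, .none, .noObject, true⟩,
  ⟨"B19-4", .B, .counted, 4, .structureRow, .dead, .none, .classDead, false⟩,
  ⟨"B19-5", .B, .counted, 4, .structureRow, .ok, .none, .structural, false⟩,
  ⟨"B19-6", .B, .counted, 4, .member, .ok, .obstructed, .classOkNotSemireg, true⟩,
  ⟨"B19-7", .B, .counted, 4, .member, .ok, .obstructed, .classOkNotSemireg, true⟩,
  ⟨"B19-8", .B, .counted, 4, .structureRow, .ok, .obstructed, .classOkNotSemireg, true⟩,
  ⟨"B19-N1", .B, .counted, 4, .structureRow, .none, .none, .noObject, false⟩,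
  ⟨"B19-N2", .B, .counted, 4, .structureRow, .none, .none, .noObject, false⟩,
  ⟨"B19-9", .B, .counted, 4, .structureRow, .ok, .obstructed, .structural, false⟩,
  ⟨"B19-10", .B, .counted, 4, .structureRow, .ok, .none, .structural, false⟩,
  ⟨"B19-N3", .B, .counted, 4, .structureRow, .none, .none, .noObject, false⟩,
  ⟨"B19-N4", .B, .counted, 4, .structureRow, .none, .none, .noObject, false⟩,
  ⟨"B19-11", .B, .counted, 4, .structureRow, .ok, .none, .structural, false⟩,
  ⟨"B19-12", .B, .counted, 4, .structureRow, .ok, .obstructed, .structural, false⟩,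
  ⟨"B19-13", .B, .counted, 4, .structureRow, .ok, .obstructed, .structural, false⟩,
  ⟨"B19-14", .B, .counted, 4, .structureRow, .ok, .obstructed, .structural, false⟩,
  ⟨"B19-15", .B, .counted, 4, .structureRow, .ok, .undecided, .openOrUndecided, false⟩,
  ⟨"B19-16", .B, .counted, 4, .structureRow, .ok, .undecided, .openOrUndecided, false⟩,
  ⟨"B19-17", .B, .counted, 4, .structureRow, .ok, .undecided, .openOrUndecided, false⟩,
  ⟨"B19-18", .B, .counted, 4, .structureRow, .ok, .undecided, .openOrUndecided, false⟩,
  ⟨"B19-19", .B, .counted, 4, .structureRow, .ok, .obstructed, .structural, false⟩,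
  ⟨"B19-20", .B, .counted, 4, .structureRow, .ok, .obstructed, .structural, true⟩,
  ⟨"B19-21", .B, .counted, 4, .structureRow, .ok, .obstructed, .structural, true⟩,
  ⟨"B19-22", .B, .counted, 4, .structureRow, .ok, .obstructed, .structural, true⟩,
  ⟨"B19-23", .B, .counted, 4, .structureRow, .ok, .none, .structural, true⟩,
  ⟨"B19-24", .B, .counted, 4, .structureRow, .ok, .obstructed, .structural, true⟩,
  ⟨"B12n4-1", .B, .counted, 4, .member, .ok, .undecided, .openOrUndecided, true⟩,
  ⟨"B12n4-2", .B, .counted, 4, .member, .ok, .undecided, .openOrUndecided, true⟩,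
  ⟨"B12n4-3", .B, .counted, 4, .member, .ok, .undecided, .openOrUndecided, true⟩,
  ⟨"CGE1-1", .C, .counted, 4, .structureRow, .none, .none, .structural, false⟩,
  ⟨"CE1-1", .C, .counted, 4, .calibration, .dead, .injective, .calibration, false⟩,
  ⟨"C22-1", .C, .counted, 4, .structureRow, .dead, .none, .structural, false⟩,
  ⟨"PS3-1", .P, .counted, 4, .structureRow, .none, .obstructed, .structural, false⟩,
  ⟨"P22-1", .P, .counted, 4, .structureRow, .dead, .none, .classDead, false⟩,
  ⟨"P22-2", .P, .counted, 4, .structureRow, .dead, .none, .noObject, false⟩,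
  ⟨"P22-3", .P, .counted, 4, .structureRow, .undecided, .none, .openOrUndecided, false⟩,
  ⟨"PS3-2", .P, .counted, 4, .structureRow, .none, .obstructed, .structural, false⟩,
  ⟨"PS3-3", .P, .listedNotCounted, 4, .structureRow, .ok, .undecided, .openOrUndecided, false⟩,
  ⟨"P22-4", .P, .listedNotCounted, 8, .structureRow, .none, .obstructed, .structural, false⟩,
  ⟨"P22-5", .P, .listedNotCounted, 4, .structureRow, .none, .none, .structural, false⟩,
  ⟨"P22-5′", .P, .listedNotCounted, 4, .structureRow, .none, .none, .structural, false⟩,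
  ⟨"P22-6", .P, .listedNotCounted, 4, .structureRow, .none, .none, .openOrUndecided, false⟩,
  ⟨"D21-1", .D, .counted, 4, .structureRow, .ok, .obstructed, .classOkNotSemireg, false⟩,
  ⟨"D21-2", .D, .counted, 4, .member, .ok, .obstructed, .classOkNotSemireg, false⟩,
  ⟨"D21-3", .D, .counted, 4, .member, .ok, .obstructed, .classOkNotSemireg, false⟩,
  ⟨"D21-4", .D, .counted, 4, .member, .ok, .obstructed, .classOkNotSemireg, false⟩,
  ⟨"D21-5", .D, .counted, 4, .member, .ok, .obstructed, .notSemireg, false⟩,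
  ⟨"D21-6", .D, .counted, 4, .structureRow, .dead, .obstructed, .classDead, false⟩,
  ⟨"D21-7", .D, .counted, 4, .structureRow, .dead, .obstructed, .classDead, false⟩,
  ⟨"D21-8", .D, .counted, 4, .structureRow, .none, .obstructed, .notSemireg, false⟩,
  ⟨"D21-9", .D, .counted, 4, .calibration, .dead, .injective, .calibration, false⟩,
  ⟨"D21-10", .D, .counted, 4, .member, .ok, .obstructed, .notSemireg, false⟩,
  ⟨"D21-11", .D, .counted, 4, .structureRow, .none, .obstructed, .structural, false⟩,
  ⟨"DC14-4", .D, .counted, 4, .structureRow, .dead, .none, .classDead, false⟩,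
  ⟨"D2-1", .D, .counted, 4, .structureRow, .dead, .none, .structural, false⟩,
  ⟨"DTH3-1", .D, .counted, 4, .structureRow, .dead, .none, .classDead, false⟩,
  ⟨"K21-1", .K, .counted, 4, .calibration, .dead, .injective, .calibration, false⟩,
  ⟨"K21-2", .K, .counted, 4, .calibration, .ok, .none, .calibration, false⟩,
  ⟨"K21-3", .K, .counted, 2, .calibration, .none, .none, .calibration, false⟩,
  ⟨"K21-4", .K, .counted, 3, .calibration, .none, .none, .calibration, false⟩,
  ⟨"K22-1", .K, .counted, 1, .calibration, .none, .injective, .calibration, false⟩,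
  ⟨"K22-2 (≡ K21-3)", .K, .alias, 2, .calibration, .none, .injective, .calibration, false⟩,
  ⟨"K22-3 (≡ K21-4)", .K, .alias, 3, .calibration, .none, .injective, .calibration, false⟩,
  ⟨"K22-4", .K, .counted, 4, .calibration, .dead, .injective, .calibration, false⟩,
  ⟨"K22-5", .K, .counted, 5, .calibration, .none, .injective, .calibration, false⟩,
  ⟨"K20-1", .K, .counted, 4, .calibration, .dead, .none, .calibration, false⟩,
  ⟨"K20-2", .K, .counted, 4, .calibration, .dead, .injective, .calibration, false⟩]


end Summit.Ventures.HSemireg.CensusG8
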